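import Summits.QuantumFields.YangMills.Theorems.BalabanUVNodesN12AtRecord13WitnessFamily
import Literature.MathematicalPhysics.QuantumFieldTheory.Balaban1983to89.B16RLeafRecord13LiveRstep

/-!
# BalabanUVNodes ∕ N12 AT RECORD 13 FROM K0b's RESIDUALS OF RECORD ALONE — N12's row at every ₁₃ live re-pin and at every live witness of the K0‴ line
# (`theta13LiveOfRecord`, the all-numerics member `theta13LiveOfNumerics n ε₂₉ …`, node00-def-K0a FILE 11a's `L`-keyed [15]-keyed witness `theta13OfThm1C`) needs
# NO PROVISO FIELD AND NO ROW P11: it follows from `HasResidualsOfRecord` + per run below the torus the (1.100) pin equation, positive mass of the LIVE pre-𝐑 terms,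
# Proposition 1 (1.78), (1.80), (1.89) — and the `stub_nodes13` sockets at `θ₁₅ᶜ = theta13OfThm1C`
# (sequel of `BalabanUVNodesN12AtRecord13LiveLine` ∕ `…WitnessFamily`; Track A, DAG node N12 = [B15, Balaban1989LargeFieldI] CMP **122** (1989) 175–202; cluster K1‴
# `StabilityBAtRecordR13e` = stmt-QuantumFields-19910 (rev 16); seat `pub-ymgap-dag-n12-d` g7 (R134 s2 = by-name knit at the record), 2026-08-27; count-neutral, NOT a discharge)

HONEST FRAMING.  Count-neutral kernel RE-KEYING BY NAME.  The ₁₃ N12 leaf of record (module 12A `b15Leaf_WOfRecord₁₃_of_massSel`, 12B `b15Leaf_WOfRecord₁₃_liveRepin₁₃_of_massLive`) reads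
node00-def-T's `Stage13Params.Provisos₁₃` ONLY through `.tstep` (fields `intPiece ∕ measω ∕ measChi ∕ zetaUnity ∕ zetaAbs`) and `.rstep` (def-R's (0.3) provisos of the pre-𝐑 tower in the
INTEGRABLE form).  `Node00/Record13` §4c (`intPiece₁₃_of_localBg`, `measω₁₃_of_localBg`, `measChi₁₃_of_localBg`, `rstep₁₃_of_localBg_liveSel`), seat K0c's ABSOLUTE measurability theorem
`localBgMeasurable` ((H-U), `Node00/Record12MeasurabilityAbsolute`), K0b's ζ-laws of the (3.16) factor of record (`HasResidualsOfRecord.zetaUnity ∕ .zetaAbs`, `zeta316OfRecord_nonneg`,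
`zetaMeasurable_zeta316OfRecord_of_localBg`) and dag-n11-e's `B16RLeafRecord13LiveRstep.rstep₁₃_of_liveSel_of_hasResiduals` make EVERY ONE of these rows a THEOREM of
`θ.HasResidualsOfRecord` at the live selector — exactly node00-def-K0a's `provisos₁₃_liveRepin₁₃_of_localBg` with its one displayed field `bg` (row P11) REMOVED, which N12 never read.
Nothing of Bałaban's is asserted; K0‴ ∕ K1‴ are NOT asserted; Proposition 1 (1.78), (1.80), (1.89), the live-mass display, the (1.100) pin equation and (on runs with `K ≤ kSel P`) the leaf
itself are DISPLAYED; N12 NOT discharged.  One finite four-torus programme at fixed `ε`; nothing continuum ∕ ℝ⁴ ∕ OS ∕ mass gap ∕ Clay.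

* §1 GENERIC `θ` ∕ `Θ` CARRYING K0b's RESIDUALS (`HasResidualsOfRecord`: `ζ = zeta316OfRecord`, `Rz = RzOfRecord`, `Zt = ZtOfRecord` — three `rfl`s for a structure-literal witness):
  `tstepProvisos₁₃_of_hasResiduals` (def-T's `TStepProvisos` at every `k < K`, ANY selector), `provisosInt_reprTOfRecord₁₃_liveRepin₁₃_of_hasResiduals` (def-R's Int provisos of the N12 knit
  datum at the live re-pin), `massSel_liveRepin₁₃_iff_of_hasResiduals` (selector-keyed masses ⟺ live masses, below the torus), ★★ `b15Leaf_WOfRecord₁₃_liveRepin₁₃_of_massLive_of_hasResiduals`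
  (N12's row at the re-pin's bundle of record, `kSel P < K`: pin equation + live-mass + Prop. 1 + (1.80) + (1.89), NO proviso field), `…_all_of_massLive_of_hasResiduals` (whole tower, run by run).
* §2 AT THE LIVE WITNESSES, ZERO K0‴-SIDE HYPOTHESES (not even admissibility or `n.Pos`): ★★★ `b15Leaf_WOfRecord₁₃_theta13LiveOfRecord_of_massLive`,
  `b15Leaf_WOfRecord₁₃_theta13LiveOfNumerics_of_massLive`, `b15Leaf_WOfRecord₁₃_theta13OfThm1C_of_massLive`, `b15Leaf_WOfRecord₁₃_theta13OfThm1C_all_of_massLive` — they feed the `h12` slot of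
  dag-n24-c's Stage-13 sockets (modules 40–42) and of 12B §4 ∕ 13D verbatim.
* §3 THE `stub_nodes13` BODY AND ITEM K1‴'s θ-KEYED CONSEQUENT OVER THE FOUR-PIN VIEW AT `θ₁₅ᶜ = theta13OfThm1C F N ε₀ ε₂₉ B₃ a₀ a₁` (13D §1 at `n := stage12NumericsOfThm1C F.L ε₀ B₃ a₀ a₁`;
  `n.Pos` ⟸ K0a's `stage12NumericsOfThm1C_pos`, the term-constant signs ⟸ dag-n11-e's `kappa∕E0∕B0_nonneg_theta13OfThm1C`, `ZtUnity` ⟸ K0b's residuals, `Admissible` ⟸ K0a): the K0‴-side input is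
  `Provisos₁₃ θ₁₅ᶜ` — consumed by the DATUM `datumOfRecord₁₃ … hP` and K0‴'s guard `SlotsNondegenerate₁₃`, NOT by N12's or N13's rows — plus the five witness signs `0 < ε₀`, `0 < ε₂₉`, `0 ≤ B₃`,
  `0 < a₀`, `0 < a₁`.  (K0a FILE 11b's separation-guarded row P11 `bgSep_theta13OfThm1C_of_thm1ScaledSep` is NOT consumed: no `.bg` reader here — director-ym LINE №137 HOLD respected.)
WHAT N12 THEN COSTS at the Stage-13 bundle of record on the witness line (typing strength, NOT a second gap): positive mass of the LIVE pre-𝐑 terms at level `kSel P + 1` (NODE 00's measure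
theory; a theorem by construction at a mass-live selector — LOCATED-4, not started), Prop. 1 at `λ.LF P`, (1.80) + the four ℍ-leaves and (1.89) (or its printed inputs via dag-n12-e's ₁₃ pins,
modules 14–15 ∕ this seat's 14C), ONE term `s P` per run, and the leaf itself on runs with `K ≤ kSel P`.  Nothing on the K0‴ side.
0 `sorry`, 0 `def`, standard axioms.  Filed `--supports` K1‴ (stmt-QuantumFields-19910) `--as helper`.
Sources: [Balaban1989LargeFieldI] (0.2)–(0.6) pp.176–177, Prop. 1 p.194, (1.80) p.195, (1.89) p.198, (1.99)–(1.102) pp.200–201; [Balaban1988Convergent] (2.12) p.256, (2.18) p.257, (3.2)–(3.9)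
pp.265–266, (3.16)–(3.25) pp.268–270; [Balaban1989LargeFieldII] Thm 1 + (0.1) pp.355–356; [Balaban1987RG1] (0.21) p.256, (1.12) p.262; [Balaban1985Variational] Thm 1 p.279 (witness letters only).
-/

noncomputable section

open MeasureTheory
open scoped Matrix.Norms.L2Operator

namespace Summit.QuantumFields.YangMills.BalabanUVNodes.N12AtRecord13OfResiduals

open Literature.MathematicalPhysics.QuantumFieldTheory.Balaban1983to89
open Literature.MathematicalPhysics.QuantumFieldTheory.Balaban1983to89.T4Continuum (T4Family)
open Literature.MathematicalPhysics.QuantumFieldTheory.Balaban1983to89.DagBinding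
open Literature.MathematicalPhysics.QuantumFieldTheory.Balaban1983to89.Node00
open FlowStep (BetaLowerH BetaUpperH)
open FlowStepRuns (genFlow)
open B15Claim189Assembly (new189 chiPP dom)
open B15 (Prop1Printed Ineq180)
open B15.BasicStep (Claim189)
open B8Eq17ClassAkV1 (plaqsOf)
open B15RPrime1100OfRep (rPrimeDataOfSel)
open B16RLeafRecord13AtLive (liveRepin₁₃_liveSel)
open B16RLeafRecord13LiveRstep (rstep₁₃_of_liveSel_of_hasResiduals kappa_nonneg_theta13OfThm1C E0_nonneg_theta13OfThm1C B0_nonneg_theta13OfThm1C)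
open Summit.QuantumFields.YangMills.BalabanUVNodes.N12AtRecord12LiveSelector (forall_mass_pos_ppSelLive_iff)
open Summit.QuantumFields.YangMills.BalabanUVNodes.N12AtRecord13LiveLine (b15Leaf_WOfRecord₁₃_liveRepin₁₃_of_provisosInt_massSel)
open Summit.QuantumFields.YangMills.BalabanUVNodes.N12AtRecord13WitnessFamily
  (nodesAtSomeRecord₁₃_of_fourPin_theta13LiveOfNumerics_of_massLive stabilityBR13e_thetaShape16_fourPin_theta13LiveOfNumerics_of_massLive)

variable {N : ℕ} [NeZero N] {F : T4Family}

/-! ## §1 GENERIC `θ` ∕ `Θ` CARRYING K0b's RESIDUALS OF RECORD — the rows N12 reads are theorems of `HasResidualsOfRecord` -/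

section Generic
variable (θ : Stage13Params F N)

/-- **def-T's STEP PROVISOS `TStepProvisos` AT EVERY STEP `k < K` ALONG THE ₁₃ HISTORIES FROM K0b's RESIDUALS OF RECORD ALONE, ANY SELECTOR** — the fields
`intPiece ∕ measW ∕ absW_le ∕ measChi ∕ unity` by `Node00/Record13` §4c over seat K0c's absolute (H-U) theorem `localBgMeasurable` and K0b's ζ-laws of the (3.16) factor
(`zetaMeasurable_zeta316OfRecord_of_localBg`, `HasResidualsOfRecord.zetaAbs ∕ .zetaUnity`, `zeta316OfRecord_nonneg`); the `hres`-keyed twin of `Provisos₁₃.tstep` — NO proviso field.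
[cite: Balaban1988Convergent, (2.12) p.256, (2.18) p.257, (3.2)–(3.9) pp.265–266, (3.16) p.268, (3.20)–(3.21) p.269, (3.24)–(3.25) p.270; Balaban1989LargeFieldI, (0.3)–(0.4) p.176 (bookkeeping)] -/
theorem tstepProvisos₁₃_of_hasResiduals (hres : θ.HasResidualsOfRecord F N) (P : B12.RunParams) (k : ℕ) (hk : k < P.K) :
    TStepProvisos F N θ.ν θ.τ9 (EOfRecord₁₃ F N θ) (wOfRecord₉ F N θ.toStage9Params) θ.ppSel P (gOfRecord₁₃ F N θ P) k :=
  have hU : LocalBgMeasurable F N θ.ν := localBgMeasurable F N θ.ν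
  have hζ : ZetaMeasurable F N θ.ζ := by
    rw [hres.zeta_eq]; exact zetaMeasurable_zeta316OfRecord_of_localBg hU θ.τ9.M θ.A₁
  have hζ0 : ∀ p g k s Pl Ql RS U V', 0 ≤ θ.ζ p g k s Pl Ql RS U V' := by
    rw [hres.zeta_eq]; exact fun p g k s Pl Ql RS U V' => zeta316OfRecord_nonneg θ.A₁ p g k s Pl Ql RS U V'
  { intPiece := θ.intPiece₁₃_of_localBg hU hζ hres.zetaAbs hζ0 P k hk
    measW := fun s' => measurable_wOfRecord F N θ.ν θ.τ9.M θ.A₁ θ.ζ P (gOfRecord₁₃ F N θ P) k (θ.measω₁₃_of_localBg hU hζ P k hk) s'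
    absW_le := fun s' U V' => abs_wOfRecord_le_one F N θ.ν θ.τ9.M θ.A₁ hres.zetaAbs P (gOfRecord₁₃ F N θ P) k s' U V'
    measChi := θ.measChi₁₃_of_localBg hU P k hk
    unity := isStepUnity_wOfRecord F N θ.ν θ.τ9.M θ.A₁ hres.zetaUnity P (gOfRecord₁₃ F N θ P) k }

end Generic

section Repin
variable (Θ : Stage13Params F N) (lam : ResidW F N)

/-- **def-R's INTEGRABLE-FORM (0.3) PROVISOS OF THE N12 KNIT DATUM AT `Tstep rep_k` OF RECORD, AT THE ₁₃ LIVE RE-PIN, FROM K0b's RESIDUALS ALONE** (`k < K`): dag-n11-e's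
`rstep₁₃_of_liveSel_of_hasResiduals` (def-T's row `rstep` is a theorem at the live selector — `Record13` §4c `rstep₁₃_of_localBg_liveSel` over K0c's `localBgMeasurable`) read through def-R's
`rfl` bridge `toRepData_towerRepOfRecord_eq`; the `hres`-keyed twin of 12A's `provisosInt_reprTOfRecord₁₃_of_provisos₁₃`. [cite: Balaban1989LargeFieldI, (0.3)–(0.4) p.176, p.177 (i)–(ii); Balaban1988Convergent, (3.22) p.269, (3.24)–(3.25) p.270 (bookkeeping)] -/
theorem provisosInt_reprTOfRecord₁₃_liveRepin₁₃_of_hasResiduals (hres : Θ.HasResidualsOfRecord F N) (P : B12.RunParams) (k : ℕ)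
    [DecidableEq (PBond (F.P P.K) (k + 1))] (hk : k < P.K) :
    (repDataOfSel (reprTOfRecord₁₃ F N (Θ.liveRepin₁₃ F N) P k)
      ((Θ.liveRepin₁₃ F N).ppSel P (gOfRecord₁₃ F N (Θ.liveRepin₁₃ F N) P) (k + 1))
      (fibOfSeq F (Θ.liveRepin₁₃ F N).ν (Θ.liveRepin₁₃ F N).τ9 P (gOfRecord₁₃ F N (Θ.liveRepin₁₃ F N) P) (k + 1))).ProvisosInt := by
  have h := rstep₁₃_of_liveSel_of_hasResiduals (liveRepin₁₃_liveSel F N Θ) (Stage13Params.HasResidualsOfRecord.liveRepin₁₃ hres) P k hk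
  rw [toRepData_towerRepOfRecord_eq] at h
  exact h

/-- **BELOW THE TORUS, AT THE ₁₃ LIVE RE-PIN OF A PARAMETER CARRYING K0b's RESIDUALS, N12's MASS DISPLAY ⟺ «every LIVE pre-𝐑 term has positive mass»** — 12B's
`massSel_liveRepin₁₃_iff` with `Provisos₁₃.tstep ∕ .rstep` at the re-pin replaced by §1's theorems of `hres` (K0a's `exists_liveSeq_ppSelLive_of_int`, this seat's g4
`forall_mass_pos_ppSelLive_iff`). [cite: Balaban1989LargeFieldI, (0.3) p.176, p.176 ll.14–16; Balaban1988Convergent, (3.16) p.268, (3.22)–(3.25) pp.269–270] -/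
theorem massSel_liveRepin₁₃_iff_of_hasResiduals (hres : Θ.HasResidualsOfRecord F N) (P : B12.RunParams) {k : ℕ} (hk : k < P.K) :
    (∀ s, 0 < ∫ V, rterm (reprTOfRecord₁₃ F N (Θ.liveRepin₁₃ F N) P k)
        ((Θ.liveRepin₁₃ F N).ppSel P (gOfRecord₁₃ F N (Θ.liveRepin₁₃ F N) P) (k + 1) s) V ∂(fieldMeasure (F.P P.K) (k + 1) (SU N))) ↔
      ∀ s, LiveSeq F N Θ.ν Θ.τ9 P (gOfRecord₁₃ F N (Θ.liveRepin₁₃ F N) P) (k + 1)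
          (slotsTOfRecord F N Θ.ν Θ.τ9 (EOfRecord₁₃ F N (Θ.liveRepin₁₃ F N)) (wOfRecord₉ F N (Θ.liveRepin₁₃ F N).toStage9Params)
            (Θ.liveRepin₁₃ F N).ppSel P (gOfRecord₁₃ F N (Θ.liveRepin₁₃ F N) P) (k + 1)) s →
        0 < ∫ V, rterm (reprTOfRecord₁₃ F N (Θ.liveRepin₁₃ F N) P k) s V ∂(fieldMeasure (F.P P.K) (k + 1) (SU N)) := by
  have hres' : (Θ.liveRepin₁₃ F N).HasResidualsOfRecord F N := Stage13Params.HasResidualsOfRecord.liveRepin₁₃ hres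
  have hex := exists_liveSeq_ppSelLive_of_int F N Θ.ν Θ.τ9 (EOfRecord₁₃ F N Θ) (wOfRecord₉ F N Θ.toStage9Params) P (gOfRecord₁₃ F N Θ P)
    (fun j hj => tstepProvisos₁₃_of_hasResiduals (Θ.liveRepin₁₃ F N) hres' P j hj)
    (fun j _ hj => rstep₁₃_of_liveSel_of_hasResiduals (liveRepin₁₃_liveSel F N Θ) hres' P j hj) k hk
  exact forall_mass_pos_ppSelLive_iff (EOfRecord₁₃ F N Θ) (wOfRecord₉ F N Θ.toStage9Params) P (gOfRecord₁₃ F N Θ P) k hex _ _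

/-- **★★ N12's ROW AT THE ₁₃ LIVE RE-PIN's BUNDLE OF RECORD FROM K0b's RESIDUALS ALONE** (`kSel P < K`): `Θ.HasResidualsOfRecord` + the (1.100) pin equation + «every LIVE pre-𝐑 term at
level `kSel P + 1` has positive mass» + EXACTLY Proposition 1 (1.78), (1.80), (1.89) ⇒ `B15Leaf (WOfRecord₁₃ (Θ.liveRepin₁₃) λ P)` — NO `Provisos₁₃`, NO row P11, NO admissibility, NO `hfib`
(12B's `b15Leaf_WOfRecord₁₃_liveRepin₁₃_of_provisosInt_massSel` fed by `provisosInt_reprTOfRecord₁₃_liveRepin₁₃_of_hasResiduals` and `massSel_liveRepin₁₃_iff_of_hasResiduals`).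
[cite: Balaban1989LargeFieldI, (0.2)–(0.6) p.176, p.176 ll.14–16, p.177 (i)–(ii), Prop. 1 (1.78) p.194, (1.80) p.195, (1.89) p.198, (1.99)–(1.102) pp.200–201; Balaban1988Convergent, (3.16) p.268, (3.22)–(3.25) pp.269–270] -/
theorem b15Leaf_WOfRecord₁₃_liveRepin₁₃_of_massLive_of_hasResiduals (hres : Θ.HasResidualsOfRecord F N) {P : B12.RunParams} (hk : lam.kSel P < P.K)
    (hpin : lam.D1100 P
      = rPrimeDataOfSel (reprTOfRecord₁₃ F N (Θ.liveRepin₁₃ F N) P (lam.kSel P))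
          ((Θ.liveRepin₁₃ F N).ppSel P (gOfRecord₁₃ F N (Θ.liveRepin₁₃ F N) P) (lam.kSel P + 1))
          (fibOfSeq F (Θ.liveRepin₁₃ F N).ν (Θ.liveRepin₁₃ F N).τ9 P (gOfRecord₁₃ F N (Θ.liveRepin₁₃ F N) P) (lam.kSel P + 1)))
    (hmassLive : ∀ s, LiveSeq F N Θ.ν Θ.τ9 P (gOfRecord₁₃ F N (Θ.liveRepin₁₃ F N) P) (lam.kSel P + 1)
        (slotsTOfRecord F N Θ.ν Θ.τ9 (EOfRecord₁₃ F N (Θ.liveRepin₁₃ F N)) (wOfRecord₉ F N (Θ.liveRepin₁₃ F N).toStage9Params)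
          (Θ.liveRepin₁₃ F N).ppSel P (gOfRecord₁₃ F N (Θ.liveRepin₁₃ F N) P) (lam.kSel P + 1)) s →
      0 < ∫ V, rterm (reprTOfRecord₁₃ F N (Θ.liveRepin₁₃ F N) P (lam.kSel P)) s V ∂(fieldMeasure (F.P P.K) (lam.kSel P + 1) (SU N)))
    (hP1 : Prop1Printed (lam.LF P))
    (h180 : ∀ U, new189 (lam.D189 P) U → ∀ i, (lam.D189 P).h ≤ i → i ≤ (lam.D189 P).k → ∀ q ∈ plaqsOf (dom (lam.D189 P) i),
      Ineq180 ((lam.D189 P).dev0 U q) ((lam.D189 P).ε (lam.D189 P).k) (lam.D189 P).η (lam.D189 P).B₃ (lam.D189 P).B₅ (lam.D189 P).M (lam.D189 P).δ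
        ((lam.D189 P).dist q) (lam.D189 P).O1)
    (h189 : Claim189 (new189 (lam.D189 P)) (chiPP (lam.D189 P))) : B15Leaf (WOfRecord₁₃ F N (Θ.liveRepin₁₃ F N) lam P) := by
  classical
  exact b15Leaf_WOfRecord₁₃_liveRepin₁₃_of_provisosInt_massSel Θ lam
    (provisosInt_reprTOfRecord₁₃_liveRepin₁₃_of_hasResiduals Θ hres P (lam.kSel P) hk) hpin
    ((massSel_liveRepin₁₃_iff_of_hasResiduals Θ hres P hk).2 hmassLive) hP1 h180 h189

/-- **N12's ROW FOR A WHOLE TOWER OF RUNS AT THE LIVE RE-PIN FROM K0b's RESIDUALS ALONE, run by run**: below the torus (`kSel P < K`) the live-mass form, on the other runs (`K ≤ kSel P`,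
where the record displays no tower clause) the leaf handed as is — the `hres`-keyed twin of 12B's `…_all_of_massLive`; feeds the `h12` slot of 12B §4 ∕ dag-n24-c's modules 40–41 verbatim.
[cite: Balaban1989LargeFieldI, (0.2)–(0.6) p.176, Prop. 1 (1.78) p.194, (1.80) p.195, (1.89) p.198, (1.99)–(1.102) pp.200–201 (bookkeeping)] -/
theorem b15Leaf_WOfRecord₁₃_liveRepin₁₃_all_of_massLive_of_hasResiduals (hres : Θ.HasResidualsOfRecord F N)
    (hdeg : ∀ P : B12.RunParams, P.K ≤ lam.kSel P → B15Leaf (WOfRecord₁₃ F N (Θ.liveRepin₁₃ F N) lam P))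
    (hpin : ∀ P : B12.RunParams, lam.kSel P < P.K → lam.D1100 P
      = rPrimeDataOfSel (reprTOfRecord₁₃ F N (Θ.liveRepin₁₃ F N) P (lam.kSel P))
          ((Θ.liveRepin₁₃ F N).ppSel P (gOfRecord₁₃ F N (Θ.liveRepin₁₃ F N) P) (lam.kSel P + 1))
          (fibOfSeq F (Θ.liveRepin₁₃ F N).ν (Θ.liveRepin₁₃ F N).τ9 P (gOfRecord₁₃ F N (Θ.liveRepin₁₃ F N) P) (lam.kSel P + 1)))
    (hmassLive : ∀ P : B12.RunParams, lam.kSel P < P.K → ∀ s, LiveSeq F N Θ.ν Θ.τ9 P (gOfRecord₁₃ F N (Θ.liveRepin₁₃ F N) P) (lam.kSel P + 1)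
        (slotsTOfRecord F N Θ.ν Θ.τ9 (EOfRecord₁₃ F N (Θ.liveRepin₁₃ F N)) (wOfRecord₉ F N (Θ.liveRepin₁₃ F N).toStage9Params)
          (Θ.liveRepin₁₃ F N).ppSel P (gOfRecord₁₃ F N (Θ.liveRepin₁₃ F N) P) (lam.kSel P + 1)) s →
      0 < ∫ V, rterm (reprTOfRecord₁₃ F N (Θ.liveRepin₁₃ F N) P (lam.kSel P)) s V ∂(fieldMeasure (F.P P.K) (lam.kSel P + 1) (SU N)))
    (hP1 : ∀ P : B12.RunParams, lam.kSel P < P.K → Prop1Printed (lam.LF P))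
    (h180 : ∀ P : B12.RunParams, lam.kSel P < P.K → ∀ U, new189 (lam.D189 P) U → ∀ i, (lam.D189 P).h ≤ i → i ≤ (lam.D189 P).k →
      ∀ q ∈ plaqsOf (dom (lam.D189 P) i),
        Ineq180 ((lam.D189 P).dev0 U q) ((lam.D189 P).ε (lam.D189 P).k) (lam.D189 P).η (lam.D189 P).B₃ (lam.D189 P).B₅ (lam.D189 P).M (lam.D189 P).δ
          ((lam.D189 P).dist q) (lam.D189 P).O1)
    (h189 : ∀ P : B12.RunParams, lam.kSel P < P.K → Claim189 (new189 (lam.D189 P)) (chiPP (lam.D189 P))) :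
    ∀ P : B12.RunParams, B15Leaf (WOfRecord₁₃ F N (Θ.liveRepin₁₃ F N) lam P) := fun P => by
  by_cases hk : lam.kSel P < P.K
  · exact b15Leaf_WOfRecord₁₃_liveRepin₁₃_of_massLive_of_hasResiduals Θ lam hres hk (hpin P hk) (hmassLive P hk) (hP1 P hk) (h180 P hk) (h189 P hk)
  · exact hdeg P (not_lt.1 hk)

end Repin
/-! ## §2 AT THE LIVE WITNESSES OF THE K0‴ LINE — N12's row with ZERO K0‴-side hypotheses -/

section Witnesses
variable (lam : ResidW F N)

/-- **★★★ N12's ROW AT node00-def-K0a's WITNESS OF RECORD `θ₁₃live = theta13LiveOfRecord F N` WITH ZERO K0‴-SIDE HYPOTHESES** (`kSel P < K`): the (1.100) pin equation (`rfl` at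
`λ.pinRPrime₁₃ θ₁₃live`) + «every LIVE pre-𝐑 term at level `kSel P + 1` has positive mass» + EXACTLY Proposition 1 (1.78), (1.80), (1.89) ⇒ `B15Leaf (WOfRecord₁₃ θ₁₃live λ P)`; K0b's
residuals of record by K0a's `hasResidualsOfRecord_theta13OfFamily` (§1 at `Θ := theta13OfFamily … eps0OfRecord₁₃ …`, whose ₁₃ live re-pin IS the witness). [cite: Balaban1989LargeFieldI, (0.2)–(0.6) p.176, p.176 ll.14–16, Prop. 1 (1.78) p.194, (1.80) p.195, (1.89) p.198, (1.99)–(1.102) pp.200–201; Balaban1988Convergent, (3.16) p.268, (3.22)–(3.25) pp.269–270] -/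
theorem b15Leaf_WOfRecord₁₃_theta13LiveOfRecord_of_massLive {P : B12.RunParams} (hk : lam.kSel P < P.K)
    (hpin : lam.D1100 P
      = rPrimeDataOfSel (reprTOfRecord₁₃ F N (theta13LiveOfRecord F N) P (lam.kSel P))
          ((theta13LiveOfRecord F N).ppSel P (gOfRecord₁₃ F N (theta13LiveOfRecord F N) P) (lam.kSel P + 1))
          (fibOfSeq F (theta13LiveOfRecord F N).ν (theta13LiveOfRecord F N).τ9 P (gOfRecord₁₃ F N (theta13LiveOfRecord F N) P) (lam.kSel P + 1)))
    (hmassLive : ∀ s, LiveSeq F N (theta13LiveOfRecord F N).ν (theta13LiveOfRecord F N).τ9 P (gOfRecord₁₃ F N (theta13LiveOfRecord F N) P) (lam.kSel P + 1)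
        (slotsTOfRecord F N (theta13LiveOfRecord F N).ν (theta13LiveOfRecord F N).τ9 (EOfRecord₁₃ F N (theta13LiveOfRecord F N)) (wOfRecord₉ F N (theta13LiveOfRecord F N).toStage9Params)
          (theta13LiveOfRecord F N).ppSel P (gOfRecord₁₃ F N (theta13LiveOfRecord F N) P) (lam.kSel P + 1)) s →
      0 < ∫ V, rterm (reprTOfRecord₁₃ F N (theta13LiveOfRecord F N) P (lam.kSel P)) s V ∂(fieldMeasure (F.P P.K) (lam.kSel P + 1) (SU N)))
    (hP1 : Prop1Printed (lam.LF P))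
    (h180 : ∀ U, new189 (lam.D189 P) U → ∀ i, (lam.D189 P).h ≤ i → i ≤ (lam.D189 P).k → ∀ q ∈ plaqsOf (dom (lam.D189 P) i),
      Ineq180 ((lam.D189 P).dev0 U q) ((lam.D189 P).ε (lam.D189 P).k) (lam.D189 P).η (lam.D189 P).B₃ (lam.D189 P).B₅ (lam.D189 P).M (lam.D189 P).δ
        ((lam.D189 P).dist q) (lam.D189 P).O1)
    (h189 : Claim189 (new189 (lam.D189 P)) (chiPP (lam.D189 P))) : B15Leaf (WOfRecord₁₃ F N (theta13LiveOfRecord F N) lam P) :=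
  b15Leaf_WOfRecord₁₃_liveRepin₁₃_of_massLive_of_hasResiduals
    (theta13OfFamily F N eps0OfRecord₁₃ (zeta316OfRecord F N (numerics7OfFamily eps0OfRecord₁₃) 1 1) (RzOfRecord F N) (ZtOfRecord F N)) lam
    (hasResidualsOfRecord_theta13OfFamily F N eps0OfRecord₁₃) hk hpin hmassLive hP1 h180 h189

variable (n : Stage12Numerics) (ε₂₉ : ℝ) in
/-- **★★ N12's ROW AT EVERY MEMBER `θ₁₃(n, ε₂₉) = theta13LiveOfNumerics F N n ε₂₉ …` OF K0a's ALL-NUMERICS WITNESS FAMILY** (FILE 9; plan's registered K0‴ skeleton line) WITH ZERO K0‴-SIDE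
HYPOTHESES — no `n.Pos`, no sign, no `Provisos₁₃`, no row P11 (K0a's `hasResidualsOfRecord_theta13OfNumerics`; §1 at `Θ := theta13OfNumerics …`). [cite: Balaban1989LargeFieldI, (0.2)–(0.6) p.176, p.176 ll.14–16, Prop. 1 (1.78) p.194, (1.80) p.195, (1.89) p.198, (1.99)–(1.102) pp.200–201; Balaban1988Convergent, (3.16) p.268, (3.22)–(3.25) pp.269–270] -/
theorem b15Leaf_WOfRecord₁₃_theta13LiveOfNumerics_of_massLive {P : B12.RunParams} (hk : lam.kSel P < P.K)
    (hpin : lam.D1100 P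
      = rPrimeDataOfSel (reprTOfRecord₁₃ F N (theta13LiveOfNumerics F N n ε₂₉ (zeta316OfRecord F N n.ν n.τ9.M n.A₁) (RzOfRecord F N) (ZtOfRecord F N)) P (lam.kSel P))
          ((theta13LiveOfNumerics F N n ε₂₉ (zeta316OfRecord F N n.ν n.τ9.M n.A₁) (RzOfRecord F N) (ZtOfRecord F N)).ppSel P (gOfRecord₁₃ F N (theta13LiveOfNumerics F N n ε₂₉ (zeta316OfRecord F N n.ν n.τ9.M n.A₁) (RzOfRecord F N) (ZtOfRecord F N)) P) (lam.kSel P + 1))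
          (fibOfSeq F (theta13LiveOfNumerics F N n ε₂₉ (zeta316OfRecord F N n.ν n.τ9.M n.A₁) (RzOfRecord F N) (ZtOfRecord F N)).ν (theta13LiveOfNumerics F N n ε₂₉ (zeta316OfRecord F N n.ν n.τ9.M n.A₁) (RzOfRecord F N) (ZtOfRecord F N)).τ9 P (gOfRecord₁₃ F N (theta13LiveOfNumerics F N n ε₂₉ (zeta316OfRecord F N n.ν n.τ9.M n.A₁) (RzOfRecord F N) (ZtOfRecord F N)) P) (lam.kSel P + 1)))
    (hmassLive : ∀ s, LiveSeq F N (theta13LiveOfNumerics F N n ε₂₉ (zeta316OfRecord F N n.ν n.τ9.M n.A₁) (RzOfRecord F N) (ZtOfRecord F N)).ν (theta13LiveOfNumerics F N n ε₂₉ (zeta316OfRecord F N n.ν n.τ9.M n.A₁) (RzOfRecord F N) (ZtOfRecord F N)).τ9 P (gOfRecord₁₃ F N (theta13LiveOfNumerics F N n ε₂₉ (zeta316OfRecord F N n.ν n.τ9.M n.A₁) (RzOfRecord F N) (ZtOfRecord F N)) P) (lam.kSel P + 1)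
        (slotsTOfRecord F N (theta13LiveOfNumerics F N n ε₂₉ (zeta316OfRecord F N n.ν n.τ9.M n.A₁) (RzOfRecord F N) (ZtOfRecord F N)).ν (theta13LiveOfNumerics F N n ε₂₉ (zeta316OfRecord F N n.ν n.τ9.M n.A₁) (RzOfRecord F N) (ZtOfRecord F N)).τ9 (EOfRecord₁₃ F N (theta13LiveOfNumerics F N n ε₂₉ (zeta316OfRecord F N n.ν n.τ9.M n.A₁) (RzOfRecord F N) (ZtOfRecord F N))) (wOfRecord₉ F N (theta13LiveOfNumerics F N n ε₂₉ (zeta316OfRecord F N n.ν n.τ9.M n.A₁) (RzOfRecord F N) (ZtOfRecord F N)).toStage9Params)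
          (theta13LiveOfNumerics F N n ε₂₉ (zeta316OfRecord F N n.ν n.τ9.M n.A₁) (RzOfRecord F N) (ZtOfRecord F N)).ppSel P (gOfRecord₁₃ F N (theta13LiveOfNumerics F N n ε₂₉ (zeta316OfRecord F N n.ν n.τ9.M n.A₁) (RzOfRecord F N) (ZtOfRecord F N)) P) (lam.kSel P + 1)) s →
      0 < ∫ V, rterm (reprTOfRecord₁₃ F N (theta13LiveOfNumerics F N n ε₂₉ (zeta316OfRecord F N n.ν n.τ9.M n.A₁) (RzOfRecord F N) (ZtOfRecord F N)) P (lam.kSel P)) s V ∂(fieldMeasure (F.P P.K) (lam.kSel P + 1) (SU N)))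
    (hP1 : Prop1Printed (lam.LF P))
    (h180 : ∀ U, new189 (lam.D189 P) U → ∀ i, (lam.D189 P).h ≤ i → i ≤ (lam.D189 P).k → ∀ q ∈ plaqsOf (dom (lam.D189 P) i),
      Ineq180 ((lam.D189 P).dev0 U q) ((lam.D189 P).ε (lam.D189 P).k) (lam.D189 P).η (lam.D189 P).B₃ (lam.D189 P).B₅ (lam.D189 P).M (lam.D189 P).δ
        ((lam.D189 P).dist q) (lam.D189 P).O1)
    (h189 : Claim189 (new189 (lam.D189 P)) (chiPP (lam.D189 P))) : B15Leaf (WOfRecord₁₃ F N (theta13LiveOfNumerics F N n ε₂₉ (zeta316OfRecord F N n.ν n.τ9.M n.A₁) (RzOfRecord F N) (ZtOfRecord F N)) lam P) :=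
  b15Leaf_WOfRecord₁₃_liveRepin₁₃_of_massLive_of_hasResiduals
    (theta13OfNumerics F N n ε₂₉ (zeta316OfRecord F N n.ν n.τ9.M n.A₁) (RzOfRecord F N) (ZtOfRecord F N)) lam
    (hasResidualsOfRecord_theta13OfNumerics F N n ε₂₉) hk hpin hmassLive hP1 h180 h189

variable (ε₀ ε₂₉ B₃ a₀ a₁ : ℝ) in
/-- **★★ N12's ROW AT node00-def-K0a FILE 11a's `L`-KEYED [15]-KEYED WITNESS `θ₁₅ᶜ = theta13OfThm1C F N ε₀ ε₂₉ B₃ a₀ a₁`** — the witness at which both halves of row P11's letter inequalities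
are theorems and the separation-guarded row P11 is stated (FILE 11b) — WITH ZERO K0‴-SIDE HYPOTHESES: not even the five witness signs (the member form at `n := stage12NumericsOfThm1C F.L ε₀ B₃ a₀ a₁`,
`rfl`). [cite: Balaban1989LargeFieldI, (0.2)–(0.6) p.176, p.176 ll.14–16, Prop. 1 (1.78) p.194, (1.80) p.195, (1.89) p.198, (1.99)–(1.102) pp.200–201; Balaban1988Convergent, (3.16) p.268, (3.22)–(3.25) pp.269–270; Balaban1985Variational, Thm 1 p.279 (witness letters only)] -/
theorem b15Leaf_WOfRecord₁₃_theta13OfThm1C_of_massLive {P : B12.RunParams} (hk : lam.kSel P < P.K)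
    (hpin : lam.D1100 P
      = rPrimeDataOfSel (reprTOfRecord₁₃ F N (theta13OfThm1C F N ε₀ ε₂₉ B₃ a₀ a₁) P (lam.kSel P))
          ((theta13OfThm1C F N ε₀ ε₂₉ B₃ a₀ a₁).ppSel P (gOfRecord₁₃ F N (theta13OfThm1C F N ε₀ ε₂₉ B₃ a₀ a₁) P) (lam.kSel P + 1))
          (fibOfSeq F (theta13OfThm1C F N ε₀ ε₂₉ B₃ a₀ a₁).ν (theta13OfThm1C F N ε₀ ε₂₉ B₃ a₀ a₁).τ9 P (gOfRecord₁₃ F N (theta13OfThm1C F N ε₀ ε₂₉ B₃ a₀ a₁) P) (lam.kSel P + 1)))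
    (hmassLive : ∀ s, LiveSeq F N (theta13OfThm1C F N ε₀ ε₂₉ B₃ a₀ a₁).ν (theta13OfThm1C F N ε₀ ε₂₉ B₃ a₀ a₁).τ9 P (gOfRecord₁₃ F N (theta13OfThm1C F N ε₀ ε₂₉ B₃ a₀ a₁) P) (lam.kSel P + 1)
        (slotsTOfRecord F N (theta13OfThm1C F N ε₀ ε₂₉ B₃ a₀ a₁).ν (theta13OfThm1C F N ε₀ ε₂₉ B₃ a₀ a₁).τ9 (EOfRecord₁₃ F N (theta13OfThm1C F N ε₀ ε₂₉ B₃ a₀ a₁)) (wOfRecord₉ F N (theta13OfThm1C F N ε₀ ε₂₉ B₃ a₀ a₁).toStage9Params)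
          (theta13OfThm1C F N ε₀ ε₂₉ B₃ a₀ a₁).ppSel P (gOfRecord₁₃ F N (theta13OfThm1C F N ε₀ ε₂₉ B₃ a₀ a₁) P) (lam.kSel P + 1)) s →
      0 < ∫ V, rterm (reprTOfRecord₁₃ F N (theta13OfThm1C F N ε₀ ε₂₉ B₃ a₀ a₁) P (lam.kSel P)) s V ∂(fieldMeasure (F.P P.K) (lam.kSel P + 1) (SU N)))
    (hP1 : Prop1Printed (lam.LF P))
    (h180 : ∀ U, new189 (lam.D189 P) U → ∀ i, (lam.D189 P).h ≤ i → i ≤ (lam.D189 P).k → ∀ q ∈ plaqsOf (dom (lam.D189 P) i),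
      Ineq180 ((lam.D189 P).dev0 U q) ((lam.D189 P).ε (lam.D189 P).k) (lam.D189 P).η (lam.D189 P).B₃ (lam.D189 P).B₅ (lam.D189 P).M (lam.D189 P).δ
        ((lam.D189 P).dist q) (lam.D189 P).O1)
    (h189 : Claim189 (new189 (lam.D189 P)) (chiPP (lam.D189 P))) : B15Leaf (WOfRecord₁₃ F N (theta13OfThm1C F N ε₀ ε₂₉ B₃ a₀ a₁) lam P) :=
  b15Leaf_WOfRecord₁₃_theta13LiveOfNumerics_of_massLive lam (stage12NumericsOfThm1C F.L ε₀ B₃ a₀ a₁) ε₂₉ hk hpin hmassLive hP1 h180 h189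

variable (ε₀ ε₂₉ B₃ a₀ a₁ : ℝ) in
/-- **N12's ROW FOR THE WHOLE TOWER OF RUNS AT `θ₁₅ᶜ`, run by run, ZERO K0‴-SIDE HYPOTHESES** — the `h12` slot of dag-n24-c's Stage-13 sockets ∕ of §3 below at the plan's witness: below the torus the
pin equation + live-mass + Prop. 1 + (1.80) + (1.89); on runs with `K ≤ kSel P` the leaf handed. [cite: Balaban1989LargeFieldI, (0.2)–(0.6) p.176, Prop. 1 (1.78) p.194, (1.80) p.195, (1.89) p.198, (1.99)–(1.102) pp.200–201 (bookkeeping)] -/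
theorem b15Leaf_WOfRecord₁₃_theta13OfThm1C_all_of_massLive
    (hdeg : ∀ P : B12.RunParams, P.K ≤ lam.kSel P → B15Leaf (WOfRecord₁₃ F N (theta13OfThm1C F N ε₀ ε₂₉ B₃ a₀ a₁) lam P))
    (hpin : ∀ P : B12.RunParams, lam.kSel P < P.K → lam.D1100 P
      = rPrimeDataOfSel (reprTOfRecord₁₃ F N (theta13OfThm1C F N ε₀ ε₂₉ B₃ a₀ a₁) P (lam.kSel P))
          ((theta13OfThm1C F N ε₀ ε₂₉ B₃ a₀ a₁).ppSel P (gOfRecord₁₃ F N (theta13OfThm1C F N ε₀ ε₂₉ B₃ a₀ a₁) P) (lam.kSel P + 1))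
          (fibOfSeq F (theta13OfThm1C F N ε₀ ε₂₉ B₃ a₀ a₁).ν (theta13OfThm1C F N ε₀ ε₂₉ B₃ a₀ a₁).τ9 P (gOfRecord₁₃ F N (theta13OfThm1C F N ε₀ ε₂₉ B₃ a₀ a₁) P) (lam.kSel P + 1)))
    (hmassLive : ∀ P : B12.RunParams, lam.kSel P < P.K → ∀ s, LiveSeq F N (theta13OfThm1C F N ε₀ ε₂₉ B₃ a₀ a₁).ν (theta13OfThm1C F N ε₀ ε₂₉ B₃ a₀ a₁).τ9 P (gOfRecord₁₃ F N (theta13OfThm1C F N ε₀ ε₂₉ B₃ a₀ a₁) P) (lam.kSel P + 1)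
        (slotsTOfRecord F N (theta13OfThm1C F N ε₀ ε₂₉ B₃ a₀ a₁).ν (theta13OfThm1C F N ε₀ ε₂₉ B₃ a₀ a₁).τ9 (EOfRecord₁₃ F N (theta13OfThm1C F N ε₀ ε₂₉ B₃ a₀ a₁)) (wOfRecord₉ F N (theta13OfThm1C F N ε₀ ε₂₉ B₃ a₀ a₁).toStage9Params)
          (theta13OfThm1C F N ε₀ ε₂₉ B₃ a₀ a₁).ppSel P (gOfRecord₁₃ F N (theta13OfThm1C F N ε₀ ε₂₉ B₃ a₀ a₁) P) (lam.kSel P + 1)) s →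
      0 < ∫ V, rterm (reprTOfRecord₁₃ F N (theta13OfThm1C F N ε₀ ε₂₉ B₃ a₀ a₁) P (lam.kSel P)) s V ∂(fieldMeasure (F.P P.K) (lam.kSel P + 1) (SU N)))
    (hP1 : ∀ P : B12.RunParams, lam.kSel P < P.K → Prop1Printed (lam.LF P))
    (h180 : ∀ P : B12.RunParams, lam.kSel P < P.K → ∀ U, new189 (lam.D189 P) U → ∀ i, (lam.D189 P).h ≤ i → i ≤ (lam.D189 P).k →
      ∀ q ∈ plaqsOf (dom (lam.D189 P) i),
        Ineq180 ((lam.D189 P).dev0 U q) ((lam.D189 P).ε (lam.D189 P).k) (lam.D189 P).η (lam.D189 P).B₃ (lam.D189 P).B₅ (lam.D189 P).M (lam.D189 P).δ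
          ((lam.D189 P).dist q) (lam.D189 P).O1)
    (h189 : ∀ P : B12.RunParams, lam.kSel P < P.K → Claim189 (new189 (lam.D189 P)) (chiPP (lam.D189 P))) :
    ∀ P : B12.RunParams, B15Leaf (WOfRecord₁₃ F N (theta13OfThm1C F N ε₀ ε₂₉ B₃ a₀ a₁) lam P) :=
  b15Leaf_WOfRecord₁₃_liveRepin₁₃_all_of_massLive_of_hasResiduals
    (theta13OfNumerics F N (stage12NumericsOfThm1C F.L ε₀ B₃ a₀ a₁) ε₂₉ (zeta316OfRecord F N (stage12NumericsOfThm1C F.L ε₀ B₃ a₀ a₁).ν (stage12NumericsOfThm1C F.L ε₀ B₃ a₀ a₁).τ9.M (stage12NumericsOfThm1C F.L ε₀ B₃ a₀ a₁).A₁) (RzOfRecord F N) (ZtOfRecord F N)) lam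
    (hasResidualsOfRecord_theta13OfNumerics F N (stage12NumericsOfThm1C F.L ε₀ B₃ a₀ a₁) ε₂₉) hdeg hpin hmassLive hP1 h180 h189

end Witnesses
/-! ## §3 SOCKETS AT THE PLAN's `L`-KEYED WITNESS `θ₁₅ᶜ = theta13OfThm1C F N ε₀ ε₂₉ B₃ a₀ a₁` — the `stub_nodes13` body and item K1‴'s θ-keyed consequent over the four-pin view, N12 resolved -/

section Thm1CSockets
variable (ε₀ ε₂₉ B₃ a₀ a₁ : ℝ) (lamW : ResidW F N)

/-- **★ THE BODY OF `NodesAtSomeRecord13` (plan g66 `stub_nodes13`) OVER THE FOUR-PIN STAGE-13 VIEW AT `θ₁₅ᶜ = theta13OfThm1C`, N12's ROW REPLACED BY ITS PER-RUN DISPLAYS** — 13D §1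
(`nodesAtSomeRecord₁₃_of_fourPin_theta13LiveOfNumerics_of_massLive`) at `n := stage12NumericsOfThm1C F.L ε₀ B₃ a₀ a₁` (`θ₁₅ᶜ` IS that member, `rfl`): `n.Pos` ⟸ K0a's `stage12NumericsOfThm1C_pos`
under the five witness signs, the term-constant signs ⟸ dag-n11-e's `kappa∕E0∕B0_nonneg_theta13OfThm1C`, `Admissible` ∕ `ZtUnity` ⟸ K0a ∕ K0b, guard and N13's (R₁₃) row as in 12B §4.  DISPLAYED
K0‴-side: `Provisos₁₃ θ₁₅ᶜ` (consumed by the DATUM `datumOfRecord₁₃ … hP` and by K0‴'s guard `SlotsNondegenerate₁₃` — N12's and N13's rows need it NOT, §1–§2 and dag-n11-e's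
`rOpLeaf_VOfRecord₁₃_theta13OfThm1C`), the world binding at the four-pin view, the rows N05–N11, N13 (UV₁₃), and N12's printed displays per run.  K0a FILE 11b's separation-guarded
row P11 is NOT consumed (no `.bg` reader).  COMPOSITE: nothing discharged as a node. [cite: Balaban1989LargeFieldII, Thm 1 p.355, (0.1) pp.355–356; Balaban1989LargeFieldI, (0.2)–(0.6) p.176, Prop. 1 (1.78) p.194, (1.80) p.195, (1.89) p.198, (1.99)–(1.102) pp.200–201; Balaban1988Convergent, (2.10) p.256, (3.16)–(3.25) pp.268–270; Balaban1985Variational, Thm 1 p.279 (witness letters only)] -/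
theorem nodesAtSomeRecord₁₃_of_fourPin_theta13OfThm1C_of_massLive (hε : 0 < ε₀) (hε' : 0 < ε₂₉) (hB : 0 ≤ B₃) (ha₀ : 0 < a₀) (ha₁ : 0 < a₁)
    (hP : (theta13OfThm1C F N ε₀ ε₂₉ B₃ a₀ a₁).Provisos₁₃ F N)
    (Mstar : ℕ) (ops : OpsY N (theta13OfThm1C F N ε₀ ε₂₉ B₃ a₀ a₁).toStage3Params Mstar) (ζ : ResidZ F N) (w : WorldP)
    (hC : w.C = (datumOfRecord₁₃ F N (theta13OfThm1C F N ε₀ ε₂₉ B₃ a₀ a₁) hP).C) (hγ : 0 < w.γ ∧ w.γ ≤ (theta13OfThm1C F N ε₀ ε₂₉ B₃ a₀ a₁).γ) (hL : w.L = ((theta13OfThm1C F N ε₀ ε₂₉ B₃ a₀ a₁).L : ℝ))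
    (hup : ∀ P, w.up P = upOfRecord₅C F N ((theta13OfThm1C F N ε₀ ε₂₉ B₃ a₀ a₁).view₁₃B10YZW F N Mstar ops ζ lamW) P)
    (h05 : ∀ P : B12.RunParams,
      B8LeafR ((theta13OfThm1C F N ε₀ ε₂₉ B₃ a₀ a₁).res.X P).d8 ((theta13OfThm1C F N ε₀ ε₂₉ B₃ a₀ a₁).res.X P).L8 ((theta13OfThm1C F N ε₀ ε₂₉ B₃ a₀ a₁).res.X P).C₂ ((theta13OfThm1C F N ε₀ ε₂₉ B₃ a₀ a₁).res.X P).B₁'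
        ((theta13OfThm1C F N ε₀ ε₂₉ B₃ a₀ a₁).res.X P).B₀' ((theta13OfThm1C F N ε₀ ε₂₉ B₃ a₀ a₁).res.X P).B₁ ((theta13OfThm1C F N ε₀ ε₂₉ B₃ a₀ a₁).res.X P).B₂ ((theta13OfThm1C F N ε₀ ε₂₉ B₃ a₀ a₁).res.X P).c₁
        ((theta13OfThm1C F N ε₀ ε₂₉ B₃ a₀ a₁).res.X P).inp8 ((theta13OfThm1C F N ε₀ ε₂₉ B₃ a₀ a₁).res.X P).B₀β ((theta13OfThm1C F N ε₀ ε₂₉ B₃ a₀ a₁).res.X P).loc8 ((theta13OfThm1C F N ε₀ ε₂₉ B₃ a₀ a₁).res.X P).fam8R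
        ((theta13OfThm1C F N ε₀ ε₂₉ B₃ a₀ a₁).res.X P).lan8 ((theta13OfThm1C F N ε₀ ε₂₉ B₃ a₀ a₁).res.X P).cub8 ((theta13OfThm1C F N ε₀ ε₂₉ B₃ a₀ a₁).res.X P).toAxial8)
    (h06 : B9LeafX (Y9OfRecord N (theta13OfThm1C F N ε₀ ε₂₉ B₃ a₀ a₁).toStage3Params Mstar ops))
    (h07 : B11Leaf (Z11OfRecord F N ζ))
    (h08 : PrintedUV3V N (theta13OfThm1C F N ε₀ ε₂₉ B₃ a₀ a₁).L)
    (h09 : ∀ P : B12.RunParams, B12Sec2to5.Lemma4Printed ((theta13OfThm1C F N ε₀ ε₂₉ B₃ a₀ a₁).res.X P).F12 ((theta13OfThm1C F N ε₀ ε₂₉ B₃ a₀ a₁).res.X P).c12)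
    (h09T : ∀ P : B12.RunParams, (leavesP w P).smallCouplings → (leavesP w P).smallFieldInductive)
    (h10 : ∀ P : B12.RunParams, B9LeafX (Y9OfRecord N (theta13OfThm1C F N ε₀ ε₂₉ B₃ a₀ a₁).toStage3Params Mstar ops) →
      (B10.Thm1PrintedCompact (((theta13OfThm1C F N ε₀ ε₂₉ B₃ a₀ a₁).view₁₃B10YZW F N Mstar ops ζ lamW).res.X P).runs10 ∧
          B10.Thm2Printed (((theta13OfThm1C F N ε₀ ε₂₉ B₃ a₀ a₁).view₁₃B10YZW F N Mstar ops ζ lamW).res.X P).runs10) →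
        B11Leaf (Z11OfRecord F N ζ) → B12Sec2to5.Lemma4Printed ((theta13OfThm1C F N ε₀ ε₂₉ B₃ a₀ a₁).res.X P).F12 ((theta13OfThm1C F N ε₀ ε₂₉ B₃ a₀ a₁).res.X P).c12 →
          B13.Lemma1Printed ((theta13OfThm1C F N ε₀ ε₂₉ B₃ a₀ a₁).res.X P).S13 ((theta13OfThm1C F N ε₀ ε₂₉ B₃ a₀ a₁).res.X P).c13 ∧
            B13.Lemma2Printed ((theta13OfThm1C F N ε₀ ε₂₉ B₃ a₀ a₁).res.X P).S13 ((theta13OfThm1C F N ε₀ ε₂₉ B₃ a₀ a₁).res.X P).c13 ∧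
            B13.Lemma3Printed ((theta13OfThm1C F N ε₀ ε₂₉ B₃ a₀ a₁).res.X P).S13 ((theta13OfThm1C F N ε₀ ε₂₉ B₃ a₀ a₁).res.X P).c13)
    (h11 : ∀ P : B12.RunParams, (leavesP w P).b7 → (leavesP w P).b8 → (leavesP w P).b9 → (leavesP w P).b10 → (leavesP w P).b11 →
      (leavesP w P).smallCouplings → (leavesP w P).smallFieldInductive → (leavesP w P).flowControl →
        ∀ k, k < P.K → SLaw₁₃ F N (theta13OfThm1C F N ε₀ ε₂₉ B₃ a₀ a₁) P k → TLaw₁₃ F N (theta13OfThm1C F N ε₀ ε₂₉ B₃ a₀ a₁) P k)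
    (h12deg : ∀ P : B12.RunParams, P.K ≤ lamW.kSel P → B15Leaf (WOfRecord₁₃ F N (theta13OfThm1C F N ε₀ ε₂₉ B₃ a₀ a₁) lamW P))
    (h12pin : ∀ P : B12.RunParams, lamW.kSel P < P.K → lamW.D1100 P
      = rPrimeDataOfSel (reprTOfRecord₁₃ F N (theta13OfThm1C F N ε₀ ε₂₉ B₃ a₀ a₁) P (lamW.kSel P))
          ((theta13OfThm1C F N ε₀ ε₂₉ B₃ a₀ a₁).ppSel P (gOfRecord₁₃ F N (theta13OfThm1C F N ε₀ ε₂₉ B₃ a₀ a₁) P) (lamW.kSel P + 1))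
          (fibOfSeq F (theta13OfThm1C F N ε₀ ε₂₉ B₃ a₀ a₁).ν (theta13OfThm1C F N ε₀ ε₂₉ B₃ a₀ a₁).τ9 P (gOfRecord₁₃ F N (theta13OfThm1C F N ε₀ ε₂₉ B₃ a₀ a₁) P) (lamW.kSel P + 1)))
    (h12mass : ∀ P : B12.RunParams, lamW.kSel P < P.K → ∀ s, LiveSeq F N (theta13OfThm1C F N ε₀ ε₂₉ B₃ a₀ a₁).ν (theta13OfThm1C F N ε₀ ε₂₉ B₃ a₀ a₁).τ9 P (gOfRecord₁₃ F N (theta13OfThm1C F N ε₀ ε₂₉ B₃ a₀ a₁) P) (lamW.kSel P + 1)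
        (slotsTOfRecord F N (theta13OfThm1C F N ε₀ ε₂₉ B₃ a₀ a₁).ν (theta13OfThm1C F N ε₀ ε₂₉ B₃ a₀ a₁).τ9 (EOfRecord₁₃ F N (theta13OfThm1C F N ε₀ ε₂₉ B₃ a₀ a₁)) (wOfRecord₉ F N (theta13OfThm1C F N ε₀ ε₂₉ B₃ a₀ a₁).toStage9Params)
          (theta13OfThm1C F N ε₀ ε₂₉ B₃ a₀ a₁).ppSel P (gOfRecord₁₃ F N (theta13OfThm1C F N ε₀ ε₂₉ B₃ a₀ a₁) P) (lamW.kSel P + 1)) s →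
      0 < ∫ V, rterm (reprTOfRecord₁₃ F N (theta13OfThm1C F N ε₀ ε₂₉ B₃ a₀ a₁) P (lamW.kSel P)) s V ∂(fieldMeasure (F.P P.K) (lamW.kSel P + 1) (SU N)))
    (h12P1 : ∀ P : B12.RunParams, lamW.kSel P < P.K → Prop1Printed (lamW.LF P))
    (h12i180 : ∀ P : B12.RunParams, lamW.kSel P < P.K → ∀ U, new189 (lamW.D189 P) U → ∀ i, (lamW.D189 P).h ≤ i → i ≤ (lamW.D189 P).k →
      ∀ q ∈ plaqsOf (dom (lamW.D189 P) i),
        Ineq180 ((lamW.D189 P).dev0 U q) ((lamW.D189 P).ε (lamW.D189 P).k) (lamW.D189 P).η (lamW.D189 P).B₃ (lamW.D189 P).B₅ (lamW.D189 P).M (lamW.D189 P).δ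
          ((lamW.D189 P).dist q) (lamW.D189 P).O1)
    (h12c189 : ∀ P : B12.RunParams, lamW.kSel P < P.K → Claim189 (new189 (lamW.D189 P)) (chiPP (lamW.D189 P)))
    (hUV : ∀ P : B12.RunParams, (genFlow (betaOfRecord₁₃ F N (theta13OfThm1C F N ε₀ ε₂₉ B₃ a₀ a₁)) P.g0).InInterval w.γ P.K → ∀ k, k ≤ P.K →
      SLaw₁₃ F N (theta13OfThm1C F N ε₀ ε₂₉ B₃ a₀ a₁) P k → ∀ U : GaugeField (F.P P.K) k (SU N),
        chiβOfRecord₁₃ F N (theta13OfThm1C F N ε₀ ε₂₉ B₃ a₀ a₁) P.K (gOfRecord₁₃ F N (theta13OfThm1C F N ε₀ ε₂₉ B₃ a₀ a₁) P) k U *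
              Real.exp (-(1 / (gOfRecord₁₃ F N (theta13OfThm1C F N ε₀ ε₂₉ B₃ a₀ a₁) P k) ^ 2 * wilsonBGOfRecord F N (theta13OfThm1C F N ε₀ ε₂₉ B₃ a₀ a₁).εbg P k U)
                - w.em (gOfRecord₁₃ F N (theta13OfThm1C F N ε₀ ε₂₉ B₃ a₀ a₁) P k) * (Fintype.card (Site (F.P P.K) k) : ℝ)) ≤
            densOfRecord₁₃ F N (theta13OfThm1C F N ε₀ ε₂₉ B₃ a₀ a₁) P k U ∧
        densOfRecord₁₃ F N (theta13OfThm1C F N ε₀ ε₂₉ B₃ a₀ a₁) P k U ≤ Real.exp (w.ep (gOfRecord₁₃ F N (theta13OfThm1C F N ε₀ ε₂₉ B₃ a₀ a₁) P k) * (Fintype.card (Site (F.P P.K) k) : ℝ))) :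
    ∃ (θ' : Stage13Params F N) (h' : θ'.Provisos₁₃ F N) (w' : WorldP), (θ'.ZtUnity F N ∧ θ'.SlotsNondegenerate₁₃ F N) ∧ θ'.Admissible F N ∧
      IsRecordOfRecord₁₃C F N (datumOfRecord₁₃ F N θ' h') w' ∧ ∀ P : B12.RunParams, Nodes (leavesP w' P) :=
  nodesAtSomeRecord₁₃_of_fourPin_theta13LiveOfNumerics_of_massLive (stage12NumericsOfThm1C F.L ε₀ B₃ a₀ a₁) ε₂₉ lamW
    (stage12NumericsOfThm1C_pos hε hB ha₀ ha₁) hε' (kappa_nonneg_theta13OfThm1C F N ε₀ ε₂₉ B₃ a₀ a₁) (E0_nonneg_theta13OfThm1C F N ε₀ ε₂₉ B₃ a₀ a₁)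
    (B0_nonneg_theta13OfThm1C F N ε₀ ε₂₉ B₃ a₀ a₁) hP Mstar ops ζ w hC hγ hL hup h05 h06 h07 h08 h09 h09T h10 h11 h12deg h12pin h12mass h12P1 h12i180 h12c189 hUV

/-- **★ THE CONSEQUENT OF ITEM K1‴ `StabilityBAtRecordR13e` IN ITS θ-KEYED SHAPE, WITNESSED BY `(θ₁₅ᶜ, hP)` OVER THE FOUR-PIN VIEW, N12's ROW REPLACED BY ITS PER-RUN DISPLAYS**
(13D §1 `stabilityBR13e_thetaShape16_fourPin_theta13LiveOfNumerics_of_massLive` at `n := stage12NumericsOfThm1C F.L ε₀ B₃ a₀ a₁`; `n.Pos`, signs, `Admissible`, `ZtUnity`, guard, N13's (R₁₃)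
row DISCHARGED BY NAME; `Provisos₁₃ θ₁₅ᶜ` for the datum, the β-box pair and every other row displayed).  COMPOSITE: nothing is discharged. [cite: Balaban1989LargeFieldII, Thm 1 p.355, (0.1) pp.355–356, p.391; Balaban1989LargeFieldI, (0.2)–(0.6) p.176, Prop. 1 (1.78) p.194, (1.80) p.195, (1.89) p.198, (1.99)–(1.102) pp.200–201; Balaban1987RG1, Thm 3 p.264, (1.22) p.264; Balaban1988Convergent, (3.22)–(3.25) pp.269–270 (bookkeeping + elementary window)] -/
theorem stabilityBR13e_thetaShape16_fourPin_theta13OfThm1C_of_massLive (hε : 0 < ε₀) (hε' : 0 < ε₂₉) (hB : 0 ≤ B₃) (ha₀ : 0 < a₀) (ha₁ : 0 < a₁)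
    (hP : (theta13OfThm1C F N ε₀ ε₂₉ B₃ a₀ a₁).Provisos₁₃ F N)
    (Mstar : ℕ) (ops : OpsY N (theta13OfThm1C F N ε₀ ε₂₉ B₃ a₀ a₁).toStage3Params Mstar) (ζ : ResidZ F N) (w : WorldP)
    (hC : w.C = (datumOfRecord₁₃ F N (theta13OfThm1C F N ε₀ ε₂₉ B₃ a₀ a₁) hP).C) (hγ : 0 < w.γ ∧ w.γ ≤ (theta13OfThm1C F N ε₀ ε₂₉ B₃ a₀ a₁).γ) (hL : w.L = ((theta13OfThm1C F N ε₀ ε₂₉ B₃ a₀ a₁).L : ℝ))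
    (hup : ∀ P, w.up P = upOfRecord₅C F N ((theta13OfThm1C F N ε₀ ε₂₉ B₃ a₀ a₁).view₁₃B10YZW F N Mstar ops ζ lamW) P)
    (h05 : ∀ P : B12.RunParams,
      B8LeafR ((theta13OfThm1C F N ε₀ ε₂₉ B₃ a₀ a₁).res.X P).d8 ((theta13OfThm1C F N ε₀ ε₂₉ B₃ a₀ a₁).res.X P).L8 ((theta13OfThm1C F N ε₀ ε₂₉ B₃ a₀ a₁).res.X P).C₂ ((theta13OfThm1C F N ε₀ ε₂₉ B₃ a₀ a₁).res.X P).B₁'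
        ((theta13OfThm1C F N ε₀ ε₂₉ B₃ a₀ a₁).res.X P).B₀' ((theta13OfThm1C F N ε₀ ε₂₉ B₃ a₀ a₁).res.X P).B₁ ((theta13OfThm1C F N ε₀ ε₂₉ B₃ a₀ a₁).res.X P).B₂ ((theta13OfThm1C F N ε₀ ε₂₉ B₃ a₀ a₁).res.X P).c₁
        ((theta13OfThm1C F N ε₀ ε₂₉ B₃ a₀ a₁).res.X P).inp8 ((theta13OfThm1C F N ε₀ ε₂₉ B₃ a₀ a₁).res.X P).B₀β ((theta13OfThm1C F N ε₀ ε₂₉ B₃ a₀ a₁).res.X P).loc8 ((theta13OfThm1C F N ε₀ ε₂₉ B₃ a₀ a₁).res.X P).fam8R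
        ((theta13OfThm1C F N ε₀ ε₂₉ B₃ a₀ a₁).res.X P).lan8 ((theta13OfThm1C F N ε₀ ε₂₉ B₃ a₀ a₁).res.X P).cub8 ((theta13OfThm1C F N ε₀ ε₂₉ B₃ a₀ a₁).res.X P).toAxial8)
    (h06 : B9LeafX (Y9OfRecord N (theta13OfThm1C F N ε₀ ε₂₉ B₃ a₀ a₁).toStage3Params Mstar ops))
    (h07 : B11Leaf (Z11OfRecord F N ζ))
    (h08 : PrintedUV3V N (theta13OfThm1C F N ε₀ ε₂₉ B₃ a₀ a₁).L)
    (h09 : ∀ P : B12.RunParams, B12Sec2to5.Lemma4Printed ((theta13OfThm1C F N ε₀ ε₂₉ B₃ a₀ a₁).res.X P).F12 ((theta13OfThm1C F N ε₀ ε₂₉ B₃ a₀ a₁).res.X P).c12)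
    (h09T : ∀ P : B12.RunParams, (leavesP w P).smallCouplings → (leavesP w P).smallFieldInductive)
    (h10 : ∀ P : B12.RunParams, B9LeafX (Y9OfRecord N (theta13OfThm1C F N ε₀ ε₂₉ B₃ a₀ a₁).toStage3Params Mstar ops) →
      (B10.Thm1PrintedCompact (((theta13OfThm1C F N ε₀ ε₂₉ B₃ a₀ a₁).view₁₃B10YZW F N Mstar ops ζ lamW).res.X P).runs10 ∧
          B10.Thm2Printed (((theta13OfThm1C F N ε₀ ε₂₉ B₃ a₀ a₁).view₁₃B10YZW F N Mstar ops ζ lamW).res.X P).runs10) →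
        B11Leaf (Z11OfRecord F N ζ) → B12Sec2to5.Lemma4Printed ((theta13OfThm1C F N ε₀ ε₂₉ B₃ a₀ a₁).res.X P).F12 ((theta13OfThm1C F N ε₀ ε₂₉ B₃ a₀ a₁).res.X P).c12 →
          B13.Lemma1Printed ((theta13OfThm1C F N ε₀ ε₂₉ B₃ a₀ a₁).res.X P).S13 ((theta13OfThm1C F N ε₀ ε₂₉ B₃ a₀ a₁).res.X P).c13 ∧
            B13.Lemma2Printed ((theta13OfThm1C F N ε₀ ε₂₉ B₃ a₀ a₁).res.X P).S13 ((theta13OfThm1C F N ε₀ ε₂₉ B₃ a₀ a₁).res.X P).c13 ∧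
            B13.Lemma3Printed ((theta13OfThm1C F N ε₀ ε₂₉ B₃ a₀ a₁).res.X P).S13 ((theta13OfThm1C F N ε₀ ε₂₉ B₃ a₀ a₁).res.X P).c13)
    (h11 : ∀ P : B12.RunParams, (leavesP w P).b7 → (leavesP w P).b8 → (leavesP w P).b9 → (leavesP w P).b10 → (leavesP w P).b11 →
      (leavesP w P).smallCouplings → (leavesP w P).smallFieldInductive → (leavesP w P).flowControl →
        ∀ k, k < P.K → SLaw₁₃ F N (theta13OfThm1C F N ε₀ ε₂₉ B₃ a₀ a₁) P k → TLaw₁₃ F N (theta13OfThm1C F N ε₀ ε₂₉ B₃ a₀ a₁) P k)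
    (h12deg : ∀ P : B12.RunParams, P.K ≤ lamW.kSel P → B15Leaf (WOfRecord₁₃ F N (theta13OfThm1C F N ε₀ ε₂₉ B₃ a₀ a₁) lamW P))
    (h12pin : ∀ P : B12.RunParams, lamW.kSel P < P.K → lamW.D1100 P
      = rPrimeDataOfSel (reprTOfRecord₁₃ F N (theta13OfThm1C F N ε₀ ε₂₉ B₃ a₀ a₁) P (lamW.kSel P))
          ((theta13OfThm1C F N ε₀ ε₂₉ B₃ a₀ a₁).ppSel P (gOfRecord₁₃ F N (theta13OfThm1C F N ε₀ ε₂₉ B₃ a₀ a₁) P) (lamW.kSel P + 1))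
          (fibOfSeq F (theta13OfThm1C F N ε₀ ε₂₉ B₃ a₀ a₁).ν (theta13OfThm1C F N ε₀ ε₂₉ B₃ a₀ a₁).τ9 P (gOfRecord₁₃ F N (theta13OfThm1C F N ε₀ ε₂₉ B₃ a₀ a₁) P) (lamW.kSel P + 1)))
    (h12mass : ∀ P : B12.RunParams, lamW.kSel P < P.K → ∀ s, LiveSeq F N (theta13OfThm1C F N ε₀ ε₂₉ B₃ a₀ a₁).ν (theta13OfThm1C F N ε₀ ε₂₉ B₃ a₀ a₁).τ9 P (gOfRecord₁₃ F N (theta13OfThm1C F N ε₀ ε₂₉ B₃ a₀ a₁) P) (lamW.kSel P + 1)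
        (slotsTOfRecord F N (theta13OfThm1C F N ε₀ ε₂₉ B₃ a₀ a₁).ν (theta13OfThm1C F N ε₀ ε₂₉ B₃ a₀ a₁).τ9 (EOfRecord₁₃ F N (theta13OfThm1C F N ε₀ ε₂₉ B₃ a₀ a₁)) (wOfRecord₉ F N (theta13OfThm1C F N ε₀ ε₂₉ B₃ a₀ a₁).toStage9Params)
          (theta13OfThm1C F N ε₀ ε₂₉ B₃ a₀ a₁).ppSel P (gOfRecord₁₃ F N (theta13OfThm1C F N ε₀ ε₂₉ B₃ a₀ a₁) P) (lamW.kSel P + 1)) s →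
      0 < ∫ V, rterm (reprTOfRecord₁₃ F N (theta13OfThm1C F N ε₀ ε₂₉ B₃ a₀ a₁) P (lamW.kSel P)) s V ∂(fieldMeasure (F.P P.K) (lamW.kSel P + 1) (SU N)))
    (h12P1 : ∀ P : B12.RunParams, lamW.kSel P < P.K → Prop1Printed (lamW.LF P))
    (h12i180 : ∀ P : B12.RunParams, lamW.kSel P < P.K → ∀ U, new189 (lamW.D189 P) U → ∀ i, (lamW.D189 P).h ≤ i → i ≤ (lamW.D189 P).k →
      ∀ q ∈ plaqsOf (dom (lamW.D189 P) i),
        Ineq180 ((lamW.D189 P).dev0 U q) ((lamW.D189 P).ε (lamW.D189 P).k) (lamW.D189 P).η (lamW.D189 P).B₃ (lamW.D189 P).B₅ (lamW.D189 P).M (lamW.D189 P).δ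
          ((lamW.D189 P).dist q) (lamW.D189 P).O1)
    (h12c189 : ∀ P : B12.RunParams, lamW.kSel P < P.K → Claim189 (new189 (lamW.D189 P)) (chiPP (lamW.D189 P)))
    (hUV : ∀ P : B12.RunParams, (genFlow (betaOfRecord₁₃ F N (theta13OfThm1C F N ε₀ ε₂₉ B₃ a₀ a₁)) P.g0).InInterval w.γ P.K → ∀ k, k ≤ P.K →
      SLaw₁₃ F N (theta13OfThm1C F N ε₀ ε₂₉ B₃ a₀ a₁) P k → ∀ U : GaugeField (F.P P.K) k (SU N),
        chiβOfRecord₁₃ F N (theta13OfThm1C F N ε₀ ε₂₉ B₃ a₀ a₁) P.K (gOfRecord₁₃ F N (theta13OfThm1C F N ε₀ ε₂₉ B₃ a₀ a₁) P) k U *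
              Real.exp (-(1 / (gOfRecord₁₃ F N (theta13OfThm1C F N ε₀ ε₂₉ B₃ a₀ a₁) P k) ^ 2 * wilsonBGOfRecord F N (theta13OfThm1C F N ε₀ ε₂₉ B₃ a₀ a₁).εbg P k U)
                - w.em (gOfRecord₁₃ F N (theta13OfThm1C F N ε₀ ε₂₉ B₃ a₀ a₁) P k) * (Fintype.card (Site (F.P P.K) k) : ℝ)) ≤
            densOfRecord₁₃ F N (theta13OfThm1C F N ε₀ ε₂₉ B₃ a₀ a₁) P k U ∧
        densOfRecord₁₃ F N (theta13OfThm1C F N ε₀ ε₂₉ B₃ a₀ a₁) P k U ≤ Real.exp (w.ep (gOfRecord₁₃ F N (theta13OfThm1C F N ε₀ ε₂₉ B₃ a₀ a₁) P k) * (Fintype.card (Site (F.P P.K) k) : ℝ)))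
    (hlo : BetaLowerH w.b w.γ (datumOfRecord₁₃ F N (theta13OfThm1C F N ε₀ ε₂₉ B₃ a₀ a₁) hP).βfun)
    (hhi : BetaUpperH w.βup w.γ (datumOfRecord₁₃ F N (theta13OfThm1C F N ε₀ ε₂₉ B₃ a₀ a₁) hP).βfun) :
    ∃ (θ' : Stage13Params F N) (h' : θ'.Provisos₁₃ F N), (θ'.ZtUnity F N ∧ θ'.SlotsNondegenerate₁₃ F N) ∧ θ'.Admissible F N ∧
      B16.EndStatementBPrinted (datumOfRecord₁₃ F N θ' h').C ∧
      ∃ γ₁ : ℝ, 0 < γ₁ ∧ ∀ γ : ℝ, 0 < γ → γ ≤ γ₁ → ∃ P : B12.RunParams, 1 ≤ P.K ∧ ((datumOfRecord₁₃ F N θ' h').C P).flow.InInterval γ P.K :=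
  stabilityBR13e_thetaShape16_fourPin_theta13LiveOfNumerics_of_massLive (stage12NumericsOfThm1C F.L ε₀ B₃ a₀ a₁) ε₂₉ lamW
    (stage12NumericsOfThm1C_pos hε hB ha₀ ha₁) hε' (kappa_nonneg_theta13OfThm1C F N ε₀ ε₂₉ B₃ a₀ a₁) (E0_nonneg_theta13OfThm1C F N ε₀ ε₂₉ B₃ a₀ a₁)
    (B0_nonneg_theta13OfThm1C F N ε₀ ε₂₉ B₃ a₀ a₁) hP Mstar ops ζ w hC hγ hL hup h05 h06 h07 h08 h09 h09T h10 h11 h12deg h12pin h12mass h12P1 h12i180 h12c189 hUV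
    hlo hhi

end Thm1CSockets

end Summit.QuantumFields.YangMills.BalabanUVNodes.N12AtRecord13OfResiduals
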